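import Mathlib
import HarnessLib
import Summits.Ventures.LatticeQCDFlow.Scaling.AcceptanceVolumeFloorPi
import Summits.Ventures.LatticeQCDFlow.Scaling.AcceptanceVolumeFloorRigidityIntegralEq

/-!
# LatticeQCDFlow / Scaling — rigidity of the acceptance volume FLOOR for `m` INDEPENDENT BLOCKS on
# a GENERAL space (`Measure.pi`): `∏ᵢ acc(pᵢ, qᵢ) = acc(⊗pᵢ, ⊗qᵢ)` iff all blocks but at most one
# are hit-or-miss

HONEST FRAMING: exact (Metropolis-corrected) sampling algorithms for lattice gauge theory;
figures of merit are autocorrelation/cost numbers at stated couplings and volumes; no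
continuum-physics claim.

Venture `LatticeQCDFlow` (cell pub-lqcd), topic `Scaling`; FANOUT row 3 (`s0-u1-a`, S0-B
implementation A, GEN-14).  NEW WORK of the cell (elementary measure theory), the `m`-block
measure-theoretic form of row 3's finite `prod_accRate_eq_accRate_blockProd_iff`
(`Scaling/AcceptanceVolumeFloorRigidityBlocks`, by induction over `Fin m`) — here directly on
`Measure.pi`, with no induction and no transport of block types — in the setting of row 3's
`Scaling/AcceptanceVolumeFloorPi` (imported: finite block index `ι`, σ-finite block spaces
`(X i, μ i)`, factorised pair `P = ⊗pᵢ`, `Q = ⊗qᵢ`, the floor `prod_meanAccept_le_meanAccept_pi`) and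
with the one-block tools of row 3's `Scaling/AcceptanceVolumeFloorRigidityIntegral[Eq]` (imported:
`measure_crossLt_pos`, `cases_left_of_weights`).  Block targets `pᵢ ≥ 0` with `∫ pᵢ = 1`, block
models `qᵢ > 0`; "hit-or-miss a.e." is `∃ c, ∀ᵐ a, 0 < p a → p a / q a = c`.  NO definition.

* §1 pointwise: `prod_min_eq_min_prod_of_cases` (`∏ min(aᵢ,bᵢ) = min(∏aᵢ, ∏bᵢ)` as soon as every
  block but one shows a zero or a tie), **`prod_min_lt_min_prod`** (STRICT for positive families with
  two blocks of opposite strict orientation);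
* §2 one graded block has a THRESHOLD: **`exists_threshold_of_not_hitOrMiss`** — if `p/q` is not
  a.e. constant on `{p > 0}` there is `t > 0` with both `{0 < p, p/q < t}` and `{t < p/q}` charged
  (row 3's charged oriented pair set is covered by the rational threshold rectangles);
* §3 on `M = (⊗μ)⊗(⊗μ)`: the acceptance kernel `K` of the factorised pair and the product `L` of the
  block kernels, `∫ K dM = acc(⊗)`, `∫ L dM = ∏ᵢ accᵢ` (Fubini twice), `L ≤ K`, hence
  **`meanAccept_pi_sub_prod_eq_integral`** `acc(⊗) − ∏ᵢ accᵢ = ∫ (K − L) dM`;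
* the equality / strictness statements themselves (`∏ accᵢ = acc(⊗)` iff all blocks but at most
  one are hit-or-miss a.e.; strict for two distinct graded blocks) are the companion file
  `Scaling/AcceptanceVolumeFloorRigidityPiEq`.

Reading (value-free): for a flow factorising over independent blocks of a general configuration
space, the equilibrium acceptance equals the product of the block acceptances only when all blocks
but at most one are all-or-nothing proposals; two blocks with graded importance weights already
accept strictly more often than the product — on continuous state spaces exactly as on finite ones.
NOT CLAIMED: a quantitative excess; coupled (non-product) flows; any acceptance of ours; nothing
re-scored.
-/

namespace Summit.Ventures.LatticeQCDFlow.Theory2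

open MeasureTheory Finset Filter

/-! ## §1 Pointwise: products of minima -/

section Pointwise

variable {ι : Type*} [Fintype ι] [DecidableEq ι]

/-- `∏ᵢ min(aᵢ, bᵢ) = min(∏ᵢ aᵢ, ∏ᵢ bᵢ)` for nonnegative families in which every block except
possibly `j₀` shows a zero or a tie. [ours] -/
theorem prod_min_eq_min_prod_of_cases {a b : ι → ℝ} (ha : ∀ i, 0 ≤ a i) (hb : ∀ i, 0 ≤ b i)
    (j₀ : ι) (h : ∀ i, i ≠ j₀ → a i = 0 ∨ b i = 0 ∨ a i = b i) :
    ∏ i, min (a i) (b i) = min (∏ i, a i) (∏ i, b i) := by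
  by_cases hA : ∃ i, i ≠ j₀ ∧ a i = 0
  · obtain ⟨i, -, hi⟩ := hA
    have hm : min (a i) (b i) = 0 := by rw [hi, min_eq_left (hb i)]
    rw [prod_eq_zero (mem_univ i) hm, prod_eq_zero (mem_univ i) hi,
      min_eq_left (prod_nonneg fun k _ => hb k)]
  by_cases hB : ∃ i, i ≠ j₀ ∧ b i = 0
  · obtain ⟨i, -, hi⟩ := hB
    have hm : min (a i) (b i) = 0 := by rw [hi, min_eq_right (ha i)]
    rw [prod_eq_zero (mem_univ i) hm, prod_eq_zero (f := b) (mem_univ i) hi,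
      min_eq_right (prod_nonneg fun k _ => ha k)]
  have hab : ∀ i ∈ univ.erase j₀, b i = a i := fun i hi => by
    have hne := ne_of_mem_erase hi
    rcases h i hne with h0 | h0 | h0
    · exact absurd ⟨i, hne, h0⟩ hA
    · exact absurd ⟨i, hne, h0⟩ hB
    · exact h0.symm
  have hmin : ∀ i ∈ univ.erase j₀, min (a i) (b i) = a i := fun i hi => by
    rw [hab i hi, min_self]
  rw [← mul_prod_erase univ _ (mem_univ j₀), ← mul_prod_erase univ a (mem_univ j₀),
    ← mul_prod_erase univ b (mem_univ j₀), prod_congr rfl hmin, prod_congr rfl hab,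
    min_mul_of_nonneg _ _ (prod_nonneg fun i _ => ha i)]

/-- **STRICT**: `∏ᵢ min(aᵢ, bᵢ) < min(∏ᵢ aᵢ, ∏ᵢ bᵢ)` for positive families with two distinct blocks
of opposite strict orientation (`a_j < b_j`, `b_k < a_k`). [ours] -/
theorem prod_min_lt_min_prod {a b : ι → ℝ} (ha : ∀ i, 0 < a i) (hb : ∀ i, 0 < b i) {j k : ι}
    (hjk : j ≠ k) (hj : a j < b j) (hk : b k < a k) :
    ∏ i, min (a i) (b i) < min (∏ i, a i) (∏ i, b i) := by
  have hk' : k ∈ univ.erase j := mem_erase.2 ⟨hjk.symm, mem_univ k⟩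
  set R := ∏ i ∈ (univ.erase j).erase k, min (a i) (b i) with hRdef
  have hRa : R ≤ ∏ i ∈ (univ.erase j).erase k, a i :=
    prod_le_prod (fun i _ => (lt_min (ha i) (hb i)).le) fun i _ => min_le_left _ _
  have hRb : R ≤ ∏ i ∈ (univ.erase j).erase k, b i :=
    prod_le_prod (fun i _ => (lt_min (ha i) (hb i)).le) fun i _ => min_le_right _ _
  have hL : ∏ i, min (a i) (b i) = a j * (b k * R) := by
    rw [← mul_prod_erase univ _ (mem_univ j), ← mul_prod_erase _ _ hk', min_eq_left hj.le,
      min_eq_right hk.le]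
  have hPa : ∏ i, a i = a j * (a k * ∏ i ∈ (univ.erase j).erase k, a i) := by
    rw [mul_prod_erase _ _ hk', mul_prod_erase _ _ (mem_univ j)]
  have hPb : ∏ i, b i = b j * (b k * ∏ i ∈ (univ.erase j).erase k, b i) := by
    rw [mul_prod_erase _ _ hk', mul_prod_erase _ _ (mem_univ j)]
  rw [hL]
  refine lt_min ?_ ?_
  · rw [hPa]
    refine mul_lt_mul_of_pos_left ?_ (ha j)
    calc b k * R ≤ b k * ∏ i ∈ (univ.erase j).erase k, a i :=
          mul_le_mul_of_nonneg_left hRa (hb k).le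
      _ < a k * ∏ i ∈ (univ.erase j).erase k, a i :=
          mul_lt_mul_of_pos_right hk (prod_pos fun i _ => ha i)
  · rw [hPb]
    calc a j * (b k * R) ≤ a j * (b k * ∏ i ∈ (univ.erase j).erase k, b i) :=
          mul_le_mul_of_nonneg_left (mul_le_mul_of_nonneg_left hRb (hb k).le) (ha j).le
      _ < b j * (b k * ∏ i ∈ (univ.erase j).erase k, b i) :=
          mul_lt_mul_of_pos_right hj (mul_pos (hb k) (prod_pos fun i _ => hb i))

end Pointwise

/-! ## §2 A graded block has a threshold -/

section OneBlock

variable {Y : Type*} [MeasurableSpace Y] {ν : Measure Y} [SFinite ν] {p q : Y → ℝ}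

/-- **A GRADED BLOCK HAS A THRESHOLD.**  If `p/q` is not a.e. constant on `{p > 0}` (the block is not
hit-or-miss a.e.) then some `t > 0` has both `{0 < p, p/q < t}` and `{t < p/q}` of positive measure:
row 3's charged oriented pair set `{0 < p(a)q(b) < p(b)q(a)}` is covered by the countably many
rectangles `{0 < p, p/q < t} × {t < p/q}`, `t ∈ ℚ`. [ours] -/
theorem exists_threshold_of_not_hitOrMiss (hp0 : ∀ a, 0 ≤ p a) (hpm : Measurable p)
    (hp1 : ∫ a, p a ∂ν = 1) (hq0 : ∀ a, 0 < q a) (hqm : Measurable q)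
    (h : ¬ ∃ c : ℝ, ∀ᵐ a ∂ν, 0 < p a → p a / q a = c) :
    ∃ t : ℝ, 0 < t ∧ ν {a | 0 < p a ∧ p a / q a < t} ≠ 0 ∧ ν {a | t < p a / q a} ≠ 0 := by
  have hS := measure_crossLt_pos hp0 hpm hp1 hq0 hqm h
  by_contra hcon
  have hrect : ∀ t : ℚ, (ν.prod ν)
      ({a | 0 < p a ∧ p a / q a < (t : ℝ)} ×ˢ {a | ((t : ℝ)) < p a / q a}) = 0 := by
    intro t
    rw [Measure.prod_prod]
    by_cases ht : (0 : ℝ) < t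
    · by_contra hne
      obtain ⟨h1, h2⟩ := mul_ne_zero_iff.1 hne
      exact hcon ⟨t, ht, h1, h2⟩
    · have h0 : ν {a | 0 < p a ∧ p a / q a < (t : ℝ)} = 0 := by
        refine measure_mono_null (fun a ha => ?_) (measure_empty (μ := ν))
        exact ht ((div_pos ha.1 (hq0 a)).trans ha.2)
      rw [h0, zero_mul]
  have hcover : {z : Y × Y | 0 < p z.1 * q z.2 ∧ p z.1 * q z.2 < p z.2 * q z.1}
      ⊆ ⋃ t : ℚ, {a | 0 < p a ∧ p a / q a < (t : ℝ)} ×ˢ {a | ((t : ℝ)) < p a / q a} := by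
    rintro ⟨a, b⟩ ⟨hab, hlt⟩
    have hpa : 0 < p a := pos_of_mul_pos_left hab (hq0 b).le
    have hw : p a / q a < p b / q b := by
      rw [div_lt_div_iff₀ (hq0 a) (hq0 b)]
      exact hlt
    obtain ⟨t, h1, h2⟩ := exists_rat_btwn hw
    exact Set.mem_iUnion.2 ⟨t, ⟨hpa, h1⟩, h2⟩
  exact hS.ne' (measure_mono_null hcover (measure_iUnion_null_iff.2 hrect))

end OneBlock

/-! ## §3 The acceptance kernel and the product of the block kernels on `(⊗μ)⊗(⊗μ)` -/

section Blocks

variable {ι : Type*} [Fintype ι] {X : ι → Type*} [∀ i, MeasurableSpace (X i)]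
  {μ : (i : ι) → Measure (X i)} [∀ i, SigmaFinite (μ i)] {p q : (i : ι) → X i → ℝ}

omit [∀ i, SigmaFinite (μ i)] in
/-- Measurability of the product `L` of the block kernels. [folklore] -/
theorem measurable_piBlockKernelProd (hpm : ∀ i, Measurable (p i)) (hqm : ∀ i, Measurable (q i)) :
    Measurable fun e : ((i : ι) → X i) × ((i : ι) → X i) =>
      ∏ i, min (p i (e.1 i) * q i (e.2 i)) (p i (e.2 i) * q i (e.1 i)) := by
  refine Finset.measurable_prod _ fun i _ => ?_
  have h1 : Measurable fun e : ((i : ι) → X i) × ((i : ι) → X i) => e.1 i :=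
    (measurable_pi_apply i).comp measurable_fst
  have h2 : Measurable fun e : ((i : ι) → X i) × ((i : ι) → X i) => e.2 i :=
    (measurable_pi_apply i).comp measurable_snd
  exact (((hpm i).comp h1).mul ((hqm i).comp h2)).min (((hpm i).comp h2).mul ((hqm i).comp h1))

omit [∀ i, MeasurableSpace (X i)] [∀ i, SigmaFinite (μ i)] in
/-- Pointwise `L ≤ K`. [folklore] -/
theorem piBlockKernelProd_le_piKernel (hp0 : ∀ i a, 0 ≤ p i a)
    (hq0 : ∀ i a, 0 ≤ q i a) (e : ((i : ι) → X i) × ((i : ι) → X i)) :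
    ∏ i, min (p i (e.1 i) * q i (e.2 i)) (p i (e.2 i) * q i (e.1 i))
      ≤ min ((∏ i, p i (e.1 i)) * ∏ i, q i (e.2 i)) ((∏ i, p i (e.2 i)) * ∏ i, q i (e.1 i)) := by
  rw [← prod_mul_distrib, ← prod_mul_distrib]
  exact prod_min_le_min_prod_of_nonneg _ _ _ (fun i _ => mul_nonneg (hp0 _ _) (hq0 _ _))
    fun i _ => mul_nonneg (hp0 _ _) (hq0 _ _)

/-- `K` is integrable on `(⊗μ)⊗(⊗μ)` (dominated by `P(x)Q(x′)`). [ours] -/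
theorem integrable_piKernel (hp0 : ∀ i a, 0 ≤ p i a) (hpm : ∀ i, Measurable (p i))
    (hpi : ∀ i, Integrable (p i) (μ i)) (hq0 : ∀ i a, 0 ≤ q i a) (hqm : ∀ i, Measurable (q i))
    (hqi : ∀ i, Integrable (q i) (μ i)) :
    Integrable (fun e : ((i : ι) → X i) × ((i : ι) → X i) =>
      min ((∏ i, p i (e.1 i)) * ∏ i, q i (e.2 i)) ((∏ i, p i (e.2 i)) * ∏ i, q i (e.1 i)))
      ((Measure.pi μ).prod (Measure.pi μ)) := by
  obtain ⟨hP0, hPm, hPi, -⟩ := piDensity_facts (μ := μ) hp0 hpm hpi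
  obtain ⟨hQ0, hQm, hQi, -⟩ := piDensity_facts (μ := μ) hq0 hqm hqi
  refine Integrable.mono' (hPi.mul_prod hQi)
    (((hPm.comp measurable_fst).mul (hQm.comp measurable_snd)).min
      ((hPm.comp measurable_snd).mul (hQm.comp measurable_fst))).aestronglyMeasurable
    (Eventually.of_forall fun e => ?_)
  rw [Real.norm_of_nonneg (le_min (mul_nonneg (hP0 _) (hQ0 _)) (mul_nonneg (hP0 _) (hQ0 _)))]
  exact min_le_left _ _

/-- `L` is integrable on `(⊗μ)⊗(⊗μ)` (dominated by the same function). [ours] -/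
theorem integrable_piBlockKernelProd (hp0 : ∀ i a, 0 ≤ p i a) (hpm : ∀ i, Measurable (p i))
    (hpi : ∀ i, Integrable (p i) (μ i)) (hq0 : ∀ i a, 0 ≤ q i a) (hqm : ∀ i, Measurable (q i))
    (hqi : ∀ i, Integrable (q i) (μ i)) :
    Integrable (fun e : ((i : ι) → X i) × ((i : ι) → X i) =>
      ∏ i, min (p i (e.1 i) * q i (e.2 i)) (p i (e.2 i) * q i (e.1 i)))
      ((Measure.pi μ).prod (Measure.pi μ)) := by
  obtain ⟨hP0, -, -, -⟩ := piDensity_facts (μ := μ) hp0 hpm hpi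
  obtain ⟨hQ0, -, -, -⟩ := piDensity_facts (μ := μ) hq0 hqm hqi
  refine (integrable_piKernel hp0 hpm hpi hq0 hqm hqi).mono'
    (measurable_piBlockKernelProd hpm hqm).aestronglyMeasurable (Eventually.of_forall fun e => ?_)
  rw [Real.norm_of_nonneg (prod_nonneg fun i _ =>
    le_min (mul_nonneg (hp0 _ _) (hq0 _ _)) (mul_nonneg (hp0 _ _) (hq0 _ _)))]
  exact piBlockKernelProd_le_piKernel hp0 hq0 e

/-- **`∫ L dM = ∏ᵢ acc(pᵢ, qᵢ)`** (Fubini twice over `Measure.pi`). [ours] -/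
theorem integral_piBlockKernelProd (hp0 : ∀ i a, 0 ≤ p i a) (hpm : ∀ i, Measurable (p i))
    (hpi : ∀ i, Integrable (p i) (μ i)) (hq0 : ∀ i a, 0 ≤ q i a) (hqm : ∀ i, Measurable (q i))
    (hqi : ∀ i, Integrable (q i) (μ i)) :
    ∫ e, ∏ i, min (p i (e.1 i) * q i (e.2 i)) (p i (e.2 i) * q i (e.1 i))
        ∂((Measure.pi μ).prod (Measure.pi μ))
      = ∏ i, (∫ a, ∫ b, min (p i a * q i b) (p i b * q i a) ∂(μ i) ∂(μ i)) := by
  rw [integral_prod _ (integrable_piBlockKernelProd hp0 hpm hpi hq0 hqm hqi)]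
  have inner : ∀ x : (i : ι) → X i,
      ∫ x', ∏ i, min (p i (x i) * q i (x' i)) (p i (x' i) * q i (x i)) ∂(Measure.pi μ)
        = ∏ i, ∫ b, min (p i (x i) * q i b) (p i b * q i (x i)) ∂(μ i) := fun x =>
    integral_fintype_prod_eq_prod (fun i b => min (p i (x i) * q i b) (p i b * q i (x i)))
  simp_rw [inner]
  exact integral_fintype_prod_eq_prod (μ := μ)
    fun i a => ∫ b, min (p i a * q i b) (p i b * q i a) ∂(μ i)

/-- **THE DEFECT OF THE FLOOR AS AN INTEGRAL**: `acc(⊗pᵢ, ⊗qᵢ) − ∏ᵢ acc(pᵢ, qᵢ) = ∫ (K − L) dM`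
with `K ≥ L` pointwise. [ours] -/
theorem meanAccept_pi_sub_prod_eq_integral (hp0 : ∀ i a, 0 ≤ p i a) (hpm : ∀ i, Measurable (p i))
    (hpi : ∀ i, Integrable (p i) (μ i)) (hq0 : ∀ i a, 0 ≤ q i a) (hqm : ∀ i, Measurable (q i))
    (hqi : ∀ i, Integrable (q i) (μ i)) :
    (∫ x, ∫ x', min ((∏ i, p i (x i)) * ∏ i, q i (x' i)) ((∏ i, p i (x' i)) * ∏ i, q i (x i))
        ∂(Measure.pi μ) ∂(Measure.pi μ))
      - ∏ i, (∫ a, ∫ b, min (p i a * q i b) (p i b * q i a) ∂(μ i) ∂(μ i))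
      = ∫ e, (min ((∏ i, p i (e.1 i)) * ∏ i, q i (e.2 i)) ((∏ i, p i (e.2 i)) * ∏ i, q i (e.1 i))
          - ∏ i, min (p i (e.1 i) * q i (e.2 i)) (p i (e.2 i) * q i (e.1 i)))
          ∂((Measure.pi μ).prod (Measure.pi μ)) := by
  rw [integral_sub (integrable_piKernel hp0 hpm hpi hq0 hqm hqi)
      (integrable_piBlockKernelProd hp0 hpm hpi hq0 hqm hqi),
    integral_prod _ (integrable_piKernel hp0 hpm hpi hq0 hqm hqi),
    integral_piBlockKernelProd hp0 hpm hpi hq0 hqm hqi]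

end Blocks

end Summit.Ventures.LatticeQCDFlow.Theory2
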